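import Literature.Computability.QuantumComplexity.TidyBlockFnPlaced
import HarnessLib

/-!
# BBBV 1997, Thm. 4.14 in Regev's sampler: the substitution error of the five-factor stage on a superposition of clean labels

Topic `Literature/Computability/QuantumComplexity`; sequel of `TidyBlockFnPlaced.lean` (the placed
weighted form of Bennett–Bernstein–Brassard–Vazirani 1997, Thm. 4.14 for a FUNCTION subroutine,
`normSq_placeGate_tidyCirc_sub_idealFn_le`; the five-factor stage `stage C_X C_S C_Y G = G·C_X·G·C_S·C_Y`
of Regev's sampler (J. ACM 56 (2009), art. 34, Lemma 3.14: branch block, residue block, oracle,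
erasing block, oracle) and its hybrid bound `l2Norm_stage_tidy_sub_le`; the query-weight law of a
superposition of clean labels `sum_mul_placedQueryWeight_sum_smul`). This file packages the REGISTER
hypotheses under which the hybrid bound applies to the sampler and evaluates it on a superposition
`Σ_{x ∈ T} a(x)|lab₀ x⟩` of basis labels (the Gaussian state on the box, in the application):

* `TidyBlockFn.kappaO E f` — the label action of the placed ideal gate `(U_f)_E` (the answer wires get
  `⊕ f(query)`), `kappaSt` — the label action `κ_O ∘ κ_X ∘ κ_O ∘ κ_S ∘ κ_Y` of the ideal stage;
* `TidyBlockFn.StageHyps` — the three classical blocks are unitary basis maps along `κ_X, κ_S, κ_Y`,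
  the labels of the IDEAL run at the two calls are clean on the placed subroutine wires
  (BBBV Thm. 4.14: the subroutine's ancillas are `|0…0⟩` at each call), and the erasing block `C_X`
  leaves the query wires alone (Regev: the second call "allows us to uncompute" — same query);
* `isBasisMap_stage_idealFn`, `stage_idealFn_mem_unitaryGroup`, `stage_tidyCirc_mem_unitaryGroup`,
  `queryOf_call₂` (the query at the second call is the query at the first), `injOn_call₁/₂`;
* **`TidyBlockFn.l2Norm_stage_sum_sub_le`** — for injective final labels,
  `‖stage(T_E) Φ − stage((U_f)_E) Φ‖₂ ≤ 4 √(Σ_{x ∈ T} errFn_f(Sub)(q(x)) · |a(x)|²)`, `q(x)` the query of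
  `x`, read off the label of the ideal run at the first call (BBBV Thm. 3.3 over the two calls, each
  bounded by Thm. 4.14 with the SAME weights).

Everything is proved; definitions have bodies; no named fact is introduced.

## References

* C. H. Bennett, E. Bernstein, G. Brassard, U. Vazirani, *Strengths and weaknesses of quantum
  computing*, SIAM J. Comput. 26 (1997) 1510–1523, Thm. 3.1, Thm. 3.3, Def. 4.12, Thm. 4.14
  [BennettBernsteinBrassardVazirani1997].
* O. Regev, *On lattices, learning with errors, random linear codes, and cryptography*, J. ACM 56
  (2009), art. 34; author's version arXiv:2401.03703: Lemma 3.14 (proof) [Regev2009].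
* M. A. Nielsen, I. L. Chuang, *Quantum Computation and Quantum Information*, CUP 2010, §3.2.5,
  §6.1.1 [NielsenChuang2010].
-/

noncomputable section

namespace Literature.Computability.QuantumComplexity

open Cryptography Matrix Finset

namespace TidyBlockFn

variable {ι : Type*} {N k ℓ d : ℕ}

/-! ### The label actions -/

/-- **The label action of the placed ideal gate `(U_f)_E`**: the answer wires get `⊕ f(query)`, every
other wire is kept. [cite: NielsenChuang2010, §6.1.1] -/
def kappaO (E : Fin (W k ℓ d) ↪ Fin N) (fn : QReg k → QReg ℓ) (w : QReg N) : QReg N :=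
  Function.extend E (fnTarget fn (w ∘ E)) w

/-- **The label action of the ideal stage**: `κ_O ∘ κ_X ∘ κ_O ∘ κ_S ∘ κ_Y`.
[cite: Regev2009, Lemma 3.14 (proof)] -/
def kappaSt (E : Fin (W k ℓ d) ↪ Fin N) (fn : QReg k → QReg ℓ) (κX κS κY : QReg N → QReg N) (w : QReg N) : QReg N :=
  kappaO E fn (κX (kappaO E fn (κS (κY w))))

/-- The placed ideal gate is the basis map of `kappaO`. [cite: NielsenChuang2010, §6.1.1] -/
theorem isBasisMap_kappaO (E : Fin (W k ℓ d) ↪ Fin N) (fn : QReg k → QReg ℓ) :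
    IsBasisMap (placeGate E (idealFn (d := d) fn)) (kappaO E fn) :=
  isBasisMap_placeGate_idealFn fn E

/-- `kappaO` keeps the query wires. [folklore] -/
theorem kappaO_qW (E : Fin (W k ℓ d) ↪ Fin N) (fn : QReg k → QReg ℓ) (w : QReg N) (i : Fin k) :
    kappaO E fn w (E (qW i)) = w (E (qW i)) := extend_fnTarget_qW fn E w i

/-- `kappaO` keeps the subroutine wires. [folklore] -/
theorem kappaO_dE (E : Fin (W k ℓ d) ↪ Fin N) (fn : QReg k → QReg ℓ) (w : QReg N) (j : Fin (k + d)) :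
    kappaO E fn w (E (dE k ℓ d j)) = w (E (dE k ℓ d j)) := extend_fnTarget_dE fn E w j

/-- `kappaO` XORs `f(query)` onto the answer wires. [cite: NielsenChuang2010, §6.1.1] -/
theorem kappaO_aW (E : Fin (W k ℓ d) ↪ Fin N) (fn : QReg k → QReg ℓ) (w : QReg N) (i : Fin ℓ) :
    kappaO E fn w (E (aW i)) = (w (E (aW i)) ^^ fn (queryOf E w) i) := extend_fnTarget_aW fn E w i

/-- `kappaO` keeps every wire off the placement. [folklore] -/
theorem kappaO_of_notMem (E : Fin (W k ℓ d) ↪ Fin N) (fn : QReg k → QReg ℓ) (w : QReg N) {v : Fin N}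
    (hv : v ∉ Set.range E) : kappaO E fn w v = w v := extend_fnTarget_of_notMem fn E w hv

/-- `kappaO` preserves cleanliness. [folklore] -/
theorem kappaO_mem_cleanOn (E : Fin (W k ℓ d) ↪ Fin N) (fn : QReg k → QReg ℓ) {w : QReg N} (hw : w ∈ CleanOn E) :
    kappaO E fn w ∈ CleanOn E := extend_fnTarget_mem_cleanOn fn E hw

/-- `kappaO` keeps the query. [folklore] -/
theorem queryOf_kappaO (E : Fin (W k ℓ d) ↪ Fin N) (fn : QReg k → QReg ℓ) (w : QReg N) :
    queryOf E (kappaO E fn w) = queryOf E w := queryOf_extend_fnTarget fn E w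

/-! ### The register hypotheses of the substitution -/

/-- **The register hypotheses of the oracle substitution** for the stage `G·C_X·G·C_S·C_Y` on the
superposition of the labels `lab₀ x`, `x ∈ T`: the three blocks are unitary basis maps, the labels of
the ideal run at the two calls are clean on the placed subroutine wires, and `C_X` leaves the query wires
alone. [cite: Regev2009, Lemma 3.14 (proof)] [cite: BennettBernsteinBrassardVazirani1997, Thm. 4.14 (clean calls)] -/
structure StageHyps (E : Fin (W k ℓ d) ↪ Fin N) (fn : QReg k → QReg ℓ) (CX CS CY : Matrix (QReg N) (QReg N) ℂ)
    (κX κS κY : QReg N → QReg N) (T : Finset ι) (lab₀ : ι → QReg N) : Prop where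
  /-- the erasing block is a basis map -/
  bmX : IsBasisMap CX κX
  /-- the residue block is a basis map -/
  bmS : IsBasisMap CS κS
  /-- the branch block is a basis map -/
  bmY : IsBasisMap CY κY
  /-- the blocks are unitary -/
  uX : CX ∈ Matrix.unitaryGroup (QReg N) ℂ
  uS : CS ∈ Matrix.unitaryGroup (QReg N) ℂ
  uY : CY ∈ Matrix.unitaryGroup (QReg N) ℂ
  /-- at the first call the labels are clean on the subroutine wires -/
  clean₁ : ∀ x ∈ T, κS (κY (lab₀ x)) ∈ CleanOn E
  /-- at the second call the labels are clean on the subroutine wires -/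
  clean₂ : ∀ x ∈ T, κX (kappaO E fn (κS (κY (lab₀ x)))) ∈ CleanOn E
  /-- the erasing block does not touch the query wires -/
  qX : ∀ (w : QReg N) (i : Fin k), κX w (E (qW i)) = w (E (qW i))

variable {E : Fin (W k ℓ d) ↪ Fin N} {fn : QReg k → QReg ℓ} {CX CS CY : Matrix (QReg N) (QReg N) ℂ}
  {κX κS κY : QReg N → QReg N} {T : Finset ι} {lab₀ : ι → QReg N}

/-- **The ideal stage is a basis map along `kappaSt`.** [cite: NielsenChuang2010, §3.2.5 and §6.1.1] -/
theorem isBasisMap_stage_idealFn (h : StageHyps E fn CX CS CY κX κS κY T lab₀) :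
    IsBasisMap (stage CX CS CY (placeGate E (idealFn fn))) (kappaSt E fn κX κS κY) := by
  have hO := isBasisMap_kappaO E fn (d := d)
  intro z
  rw [stage_mulVec, h.bmY, h.bmS, hO, h.bmX, hO]
  rfl

/-- The ideal stage is unitary. [folklore] -/
theorem stage_idealFn_mem_unitaryGroup (h : StageHyps E fn CX CS CY κX κS κY T lab₀) :
    stage CX CS CY (placeGate E (idealFn fn)) ∈ Matrix.unitaryGroup (QReg N) ℂ :=
  stage_mem_unitaryGroup h.uX h.uS h.uY (placeGate_idealFn_mem_unitaryGroup fn E)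

/-- The real stage (tidy blocks of `Sub`) is unitary. [folklore] -/
theorem stage_tidyCirc_mem_unitaryGroup (h : StageHyps E fn CX CS CY κX κS κY T lab₀) (Sub : QCircuit cliffordT (k + d)) :
    stage CX CS CY (placeGate E (tidyCirc (ℓ := ℓ) Sub).mat) ∈ Matrix.unitaryGroup (QReg N) ℂ :=
  stage_mem_unitaryGroup h.uX h.uS h.uY (placeGate_tidyCirc_mem_unitaryGroup Sub E)

/-- **The query is the same at both calls**: `C_X` and `U_f` leave the query wires alone. [folklore] -/
theorem queryOf_call₂ (h : StageHyps E fn CX CS CY κX κS κY T lab₀) (w : QReg N) :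
    queryOf E (κX (kappaO E fn w)) = queryOf E w := by
  funext i
  rw [queryOf_apply, queryOf_apply, h.qX, kappaO_qW]

/-- Injectivity at the first call from injectivity of the final labels. [folklore] -/
theorem injOn_call₁ (hinj : Set.InjOn (kappaSt E fn κX κS κY ∘ lab₀) T) :
    Set.InjOn (fun x => κS (κY (lab₀ x))) T := fun x hx x' hx' heq =>
  hinj hx hx' (by
    simp only [Function.comp_apply, kappaSt]
    rw [show κS (κY (lab₀ x)) = κS (κY (lab₀ x')) from heq])

/-- Injectivity at the second call. [folklore] -/
theorem injOn_call₂ (hinj : Set.InjOn (kappaSt E fn κX κS κY ∘ lab₀) T) :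
    Set.InjOn (fun x => κX (kappaO E fn (κS (κY (lab₀ x))))) T := fun x hx x' hx' heq =>
  hinj hx hx' (by
    simp only [Function.comp_apply, kappaSt]
    rw [show κX (kappaO E fn (κS (κY (lab₀ x)))) = κX (kappaO E fn (κS (κY (lab₀ x')))) from heq])

/-- A basis map relabels a superposition of basis states. [cite: NielsenChuang2010, §3.2.5] -/
theorem _root_.Literature.Computability.QuantumComplexity.IsBasisMap.mulVec_sum_smul {M : Matrix (QReg N) (QReg N) ℂ}
    {κ : QReg N → QReg N} (hM : IsBasisMap M κ) (T : Finset ι) (a : ι → ℂ) (lab : ι → QReg N) :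
    M *ᵥ (∑ x ∈ T, a x • basisState (lab x)) = ∑ x ∈ T, a x • basisState (κ (lab x)) := by
  rw [Matrix.mulVec_sum]
  exact sum_congr rfl fun x _ => by rw [Matrix.mulVec_smul, hM]

/-- A superposition of labels in a set is supported in it. [folklore] -/
theorem suppIn_sum_smul {P : Set (QReg N)} (T : Finset ι) (a : ι → ℂ) {lab : ι → QReg N} (h : ∀ x ∈ T, lab x ∈ P) :
    SuppIn P (∑ x ∈ T, a x • basisState (lab x)) := by
  intro z hz
  rw [Finset.sum_apply]
  exact sum_eq_zero fun x hx => by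
    rw [Pi.smul_apply, basisState_apply, if_neg (fun hzx : z = lab x => hz (hzx ▸ h x hx)), smul_zero]

/-- **The substitution error on a superposition of labels.** For `Φ = Σ_{x ∈ T} a(x)|lab₀ x⟩` with
injective final labels: `‖stage(T_E) Φ − stage((U_f)_E) Φ‖₂ ≤ 4 √(Σ_{x ∈ T} errFn_f(Sub)(q(x)) · |a(x)|²)`,
`q(x) = queryOf E (κ_S (κ_Y (lab₀ x)))` the query of `x`. [cite: BennettBernsteinBrassardVazirani1997, Thm. 3.3 with Thm. 4.14]
[cite: Regev2009, Lemma 3.14 (proof)] -/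
theorem l2Norm_stage_sum_sub_le (h : StageHyps E fn CX CS CY κX κS κY T lab₀)
    (hinj : Set.InjOn (kappaSt E fn κX κS κY ∘ lab₀) T) (a : ι → ℂ) (Sub : QCircuit cliffordT (k + d)) :
    l2Norm (stage CX CS CY (placeGate E (tidyCirc Sub).mat) *ᵥ (∑ x ∈ T, a x • basisState (lab₀ x)) -
        stage CX CS CY (placeGate E (idealFn fn)) *ᵥ (∑ x ∈ T, a x • basisState (lab₀ x))) ≤
      4 * Real.sqrt (∑ x ∈ T, errFn fn Sub (queryOf E (κS (κY (lab₀ x)))) * ‖a x‖ ^ 2) := by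
  have hO := isBasisMap_kappaO E fn (d := d)
  set Φ : QReg N → ℂ := ∑ x ∈ T, a x • basisState (lab₀ x) with hΦ
  -- the two states of the ideal run at the calls
  have hφ₁ : CS *ᵥ (CY *ᵥ Φ) = ∑ x ∈ T, a x • basisState (κS (κY (lab₀ x))) := by
    rw [hΦ, h.bmY.mulVec_sum_smul, h.bmS.mulVec_sum_smul]
  have hφ₂ : CX *ᵥ (placeGate E (idealFn fn) *ᵥ (CS *ᵥ (CY *ᵥ Φ))) =
      ∑ x ∈ T, a x • basisState (κX (kappaO E fn (κS (κY (lab₀ x))))) := by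
    rw [hφ₁, hO.mulVec_sum_smul, h.bmX.mulVec_sum_smul]
  have hs₁ : SuppIn (CleanOn E) (CS *ᵥ (CY *ᵥ Φ)) := by
    rw [hφ₁]; exact suppIn_sum_smul T a h.clean₁
  have hs₂ : SuppIn (CleanOn E) (CX *ᵥ (placeGate E (idealFn fn) *ᵥ (CS *ᵥ (CY *ᵥ Φ)))) := by
    rw [hφ₂]; exact suppIn_sum_smul T a h.clean₂
  have hmain := l2Norm_stage_tidy_sub_le fn Sub E h.uX Φ hs₁ hs₂
  -- the two weight sums are the same average of the error over the queries of the points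
  have hw₁ : ∑ q, errFn fn Sub q * placedQueryWeight E (CS *ᵥ (CY *ᵥ Φ)) q =
      ∑ x ∈ T, errFn fn Sub (queryOf E (κS (κY (lab₀ x)))) * ‖a x‖ ^ 2 := by
    rw [hφ₁]
    exact sum_mul_placedQueryWeight_sum_smul E T a _ (injOn_call₁ hinj) h.clean₁ _
  have hw₂ : ∑ q, errFn fn Sub q * placedQueryWeight E (CX *ᵥ (placeGate E (idealFn fn) *ᵥ (CS *ᵥ (CY *ᵥ Φ)))) q =
      ∑ x ∈ T, errFn fn Sub (queryOf E (κS (κY (lab₀ x)))) * ‖a x‖ ^ 2 := by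
    rw [hφ₂, sum_mul_placedQueryWeight_sum_smul E T a _ (injOn_call₂ hinj) h.clean₂ _]
    exact sum_congr rfl fun x _ => by rw [queryOf_call₂ h]
  rw [hw₁, hw₂] at hmain
  linarith

end TidyBlockFn

end Literature.Computability.QuantumComplexity

end
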